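import Summits.BirchSwinnertonDyer.BirchSwinnertonDyer.Theorems.SchneiderFreeUpperSocketsField
import Summits.BirchSwinnertonDyer.BirchSwinnertonDyer.Theorems.SchneiderFreeAdditiveX3UpperWingPotMultOfKYCHM
import Summits.BirchSwinnertonDyer.BirchSwinnertonDyer.Theorems.SchneiderFreeAdditiveX3UpperCoSocketOfKYBranch
import HarnessLib

/-!
# Schneider-free additive X3 door, SECOND WING — the glue LOCALISED AT THE TWIST-UNIT FIELD: the upper half and the
# leaf candidate WITHOUT the `d_K = −3` sliver input (`KYRead.KYReadSliverUpper` GONE), from the field-local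
# co-socket at fields with `d_K ≠ −3` and the off-sliver twist-unit datum

Cell `bsd-schneider-ideate`, seat `bsd-schneider-door-c5` (prover, generation 10). This seat's gen-9 glue
`missingUpperBoundAt_of_goodMemberCoStepL_of_twistUnitField` (p489359) uses the co-chain member's co-STEP L ONLY at
the twist-unit field `K`; so the class-wide co-socket (all socket fields, incl. `ℚ(√−3)` at `p ≥ 5`) is more than
the wing needs. With the field-local vocabulary of `…UpperSocketsField.lean`:

* §1 `missingUpperBoundAt_of_goodMemberCoStepLField_of_twistUnitFieldOffSliver` — the per-curve glue COPIED with
  `hGM` asked only at fields `K` with `p ∤ d_K` AND `d_K ≠ −3` and concluding the FIELD-LOCAL co-STEP L at `K`, and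
  the datum `TwistUnitFieldOffSliverAt W p`.
* §2 the co-chain members at a field: (G-ord) from a field-local co-socket asked only at `d_K ≠ −3`
  (`coChainMemberField_gordTwo_of_coIMCField_of_control`), (M) from the class-wide (M) co-socket
  (`coChainMemberField_potMult_of_coIMC_of_control`); the door glue
  `missingUpperBoundAt_sstTwist_of_coIMCsField_of_control_of_twistUnitFieldOffSliver` and the leaf form.
* §3 the (G-ord) FIELD-LOCAL co-socket record from the branch-currency inputs WITHOUT the sliver stub
  (`additiveIMCUpperBDPInputManinAtField_of_facts_of_KY_branch_of_CHValueUnit` — this seat's per-datum theorem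
  `additiveIMCUpperBDPOnTreeLeAt_of_KY_branch_of_valueAtUnit_conj`, whose only use of `d_K ≠ −3` is Keller–Yin's
  Assumption 2.0.3), and the leaf candidate v3:
  `additiveX3RankOneUpper_of_KYReadBranch_of_PotMultRead_of_twistUnitFieldOffSliver :
  PrintedFacts → ControlFacts → (CM-rationality ∧ CST 1.1) → (Darmon 3.6 ∧ CST 1.5) → thm351_charIdeal_eq_branch_OPEN →
  castellaHsieh2018_… → KYReadCHValueUnit → KYCHMUnitOriented → hTU′ (off-sliver) → AdditiveX3RankOneUpper` — NO
  `KYReadSliverUpper`.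

HONEST FRAMING: CONDITIONAL theorems; an ARCHITECTURE OFFER (the sibling route's r2 certificate would carry
`discr K ≠ −3`, free in the census and automatic at `p = 3`; its r3 co-skeleton loses `stub_sliverUpper`); nothing
asserted about BSD; no item closes; no rung leaf registered; BSD is NOT advanced.

References: [JetchevSkinnerWan2017] §7.4.1; [GrossZagier1986] I.(6.3), (7.3); [Miller2011LMS] Def. 1.1;
[KellerYin2024b] Thm. 3.5.1, Assumption 2.0.3; [CastellaHsieh2018] Prop. 3.8, Thm. 5.7; [Mazur1978] Prop. 5.4.
-/

noncomputable section

open scoped Classical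

open WeierstrassCurve NumberField IsDedekindDomain Field Literature.NumberTheory.EllipticCurves
  Literature.NumberTheory.EllipticCurves.ModularForms Literature.NumberTheory.EllipticCurves.GreenbergSelmer
  Literature.NumberTheory.EllipticCurves.CaiShuTian2014
  Literature.NumberTheory.EllipticCurves.Rank1Residual Literature.NumberTheory.EllipticCurves.Rank1Residual.Typed
  Literature.NumberTheory.GaloisRepresentations Literature.NumberTheory.GaloisCohomology
  Literature.NumberTheory.EllipticCurves.KellerYin2024
  Summit.BirchSwinnertonDyer.Rank1Residual Summit.BirchSwinnertonDyer.Rank1Residual.Additive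
  Summit.BirchSwinnertonDyer.Rank1Residual.X11b Summit.BirchSwinnertonDyer.Rank1Residual.X11b.AcSelmer
  Summit.BirchSwinnertonDyer.Rank1Residual.X11b.Halves Summit.BirchSwinnertonDyer.BirchSwinnertonDyer.Theorems.SchneiderFree
  Summit.BirchSwinnertonDyer.BirchSwinnertonDyer.Theorems.SchneiderFree.KYRead
  Summit.BirchSwinnertonDyer.BirchSwinnertonDyer.Theorems.SchneiderFree.PotMultRead
  Summit.BirchSwinnertonDyer.BirchSwinnertonDyer.Theses.SchneiderFreeAdditiveX3

set_option linter.dupNamespace false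
set_option autoImplicit false

namespace Summit.BirchSwinnertonDyer.BirchSwinnertonDyer.Theorems.SchneiderFree.Upper

/-! ### §1 Per-curve glue at the twist-unit field, off the sliver -/

/-- **Per-curve assembly of the upper wing from the FIELD-LOCAL co-chain and the OFF-SLIVER datum.** VERBATIM this
seat's `missingUpperBoundAt_of_goodMemberCoStepL_of_twistUnitField` (p489359) with `hGM` asked only at imaginary
quadratic Heegner fields `K` with `p ∤ d_K` and `d_K ≠ −3` and concluding the field-local co-STEP L♯
`AdditiveCoStepLInputManinAtField W₁ p K`, and the datum `TwistUnitFieldOffSliverAt W p` (its `K` has `d_K ≠ −3`).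
Route unchanged: Heegner point at `W₁` → co-STEP L at `K` → JOINT upper at `(W₁, W₁d)` → members → Cassels.
CONDITIONAL on `hGM`, `hT`; nothing asserted about BSD. [cite: GrossZagier1986, Thm. I.(6.3) and (7.3)]
[cite: Miller2011LMS, Def. 1.1] [cite: JetchevSkinnerWan2017, §7.4.1] -/
theorem missingUpperBoundAt_of_goodMemberCoStepLField_of_twistUnitFieldOffSliver
    (hGZ : ∀ (N : ℕ) [NeZero N] (W : WeierstrassCurve ℚ) (K : Type) [Field K] [NumberField K],
      gross_zagier N W K)
    (hKo : ∀ (N : ℕ) [NeZero N] (W : WeierstrassCurve ℚ) (K : Type) [Field K] [NumberField K],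
      kolyvagin N W K)
    (hGZK : rank_eq_analyticRank_of_analyticRank_le_one) (hmod : hasEntireLFunction_rat)
    (hGZ73 : GrossZagier1986_thm_I_7_3) (hCassels : bsdRHS_eq_of_isIsogenous)
    (hHP : ∀ (W : WeierstrassCurve ℚ) (K : Type) [Field K] [NumberField K], exists_isHeegnerPoint W K)
    (W : WeierstrassCurve ℚ) [W.IsElliptic] [W.IsGloballyMinimal] (p : ℕ) [Fact p.Prime]
    (hr : W.analyticRank = 1) (hp2 : p ≠ 2) (hpN : p ∣ W.conductorNorm ℤ)
    (hGM : ∀ (K : Type) [Field K] [NumberField K], IsImaginaryQuadratic K →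
      SatisfiesHeegnerHypothesis (W.conductorNorm ℤ) K → ¬ (p : ℤ) ∣ NumberField.discr K →
      NumberField.discr K ≠ -3 →
      ∃ (W₁ : WeierstrassCurve ℚ) (_ : W₁.IsElliptic) (_ : W₁.IsGloballyMinimal),
        IsIsogenous W W₁ ∧ W₁.conductorNorm ℤ = W.conductorNorm ℤ ∧ Additive.N10.Locus W₁ p ∧
        (∀ Q : (W₁.baseChange K).toAffine.Point, p • Q = 0 → Q = 0) ∧ AdditiveCoStepLInputManinAtField W₁ p K)
    (hT : TwistUnitFieldOffSliverAt W p) : MissingUpperBoundAt W p := by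
  obtain ⟨K, _, _, W₂, W₂d, _, _, _, _, hK, hodd, hdK, hHH, hLd, h2, ⟨C₂, hC₂⟩, hU⟩ := hT
  obtain ⟨hpd, hw⟩ := X11b.Three.not_dvd_discr_and_not_dvd_torsionOrder_of_heegner hK hHH hp2 hpN
  obtain ⟨W₁, _, _, h1, hN1, hLoc1, htf1, hco1⟩ := hGM K hK hHH hpd hdK
  have hD0 : (NumberField.discr K : ℚ) ≠ 0 := by exact_mod_cast NumberField.discr_ne_zero K
  haveI := W.isElliptic_quadraticTwist hD0
  haveI := W₁.isElliptic_quadraticTwist hD0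
  haveI := W₂.isElliptic_quadraticTwist hD0
  -- the co-chain member: analytic rank one, Heegner hypothesis, `L(W₁^{d_K},1) ≠ 0` (all isogeny-invariant)
  have hr1 : W₁.analyticRank = 1 := by rw [← analyticRank_eq_of_isIsogenous' h1]; exact hr
  have hHH1 : SatisfiesHeegnerHypothesis (W₁.conductorNorm ℤ) K := by rw [hN1]; exact hHH
  have hpN1 : p ∣ W₁.conductorNorm ℤ := by rw [hN1]; exact hpN
  have hLd1 : (W₁.quadraticTwist (NumberField.discr K : ℚ)).entireLFunction 1 ≠ 0 := by
    rw [← entireLFunction_eq_of_isIsogenous' (h1.quadraticTwist hD0)]; exact hLd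
  -- its Heegner point (a theorem, not part of the datum)
  haveI hN0 : NeZero (W₁.conductorNorm ℤ) := ⟨W₁.conductorNorm_pos_holds.ne'⟩
  obtain ⟨Dt, H, ι, P, hP, hnt⟩ :=
    exists_heegnerPoint_not_isOfFinAddOrder_of_twist_ne_zero hHP hGZ hmod W₁ (W₁.conductorNorm ℤ) K hr1 rfl hK
      hHH1 hLd1
  -- co-STEP L at the co-chain member AT THE FIELD `K`, then the JOINT upper half at `(W₁, W₁d)`
  have hI : IndexUpperBoundLeAt W₁ p K P (padicValNat p Dt.c.natAbs) :=
    hco1 (W₁.conductorNorm ℤ) Dt H ι P hr1 hLoc1 rfl hK hodd hw hHH1 hLd1 hP hnt htf1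
  obtain ⟨C₁, hC₁⟩ := hasGlobalMinimalModel_rat_holds (W₁.quadraticTwist (NumberField.discr K : ℚ))
  set W₁d : WeierstrassCurve ℚ := C₁ • W₁.quadraticTwist (NumberField.discr K : ℚ) with hW₁d_def
  haveI : W₁d.IsGloballyMinimal := hC₁
  have hW₁d : C₁ • W₁.quadraticTwist (NumberField.discr K : ℚ) = W₁d := rfl
  have hJ1 : JointUpperBoundAt W₁ W₁d p :=
    jointUpperBoundAt_of_coStepL_manin hGZ hKo hGZK hmod hGZ73 W₁ p (W₁.conductorNorm ℤ) K Dt H ι P W₁d hr1 rfl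
      hpN1 hK hodd hw hHH1 hLd1 hP ⟨C₁, hW₁d⟩ hp2 hI
  -- isogenies between the members and between the twists' minimal models
  have h12 : IsIsogenous W₁ W₂ := IsIsogenous.trans' h1.symm_of_isElliptic h2
  have h12d : IsIsogenous W₁d W₂d := by
    rw [← hW₁d, ← hC₂]
    exact IsIsogenous.trans' (IsIsogenous.trans' (isIsogenous_of_smul _ C₁) (h12.quadraticTwist hD0))
      (isIsogenous_smul _ C₂)
  -- analytic ranks `≤ 1` for the GZK transports
  have hrd1 : W₁d.analyticRank ≤ 1 := by
    have h0 : (W₁.quadraticTwist (NumberField.discr K : ℚ)).analyticRank = 0 :=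
      ((W₁.quadraticTwist _).analyticRank_eq_zero_iff_holds (hmod _)).2 hLd1
    rw [← hW₁d, analyticRank_smul, h0]; exact zero_le_one
  have hr2 : W₂.analyticRank ≤ 1 := by rw [← analyticRank_eq_of_isIsogenous' h2, hr]
  exact missingUpperBoundAt_of_members hCassels hGZK hmod h12 h12d h2.symm_of_isElliptic hr1.le hrd1 hr2 hJ1 hU

/-! ### §2 The co-chain members at a field, and the door glue off the sliver -/

/-- **Co-chain member on the (G-ord, `e = 2`) cell AT A FIELD `K` with `d_K ≠ −3`** — VERBATIM
`coChainMember_gordTwo_of_coIMC_of_control` with the co-socket asked FIELD-LOCALLY and only at `d_K ≠ −3` (door-c4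
gen 7's good member; modularity pays the conductor; co-STEP L at `K` by the localised U27).
[cite: KellerYin2024b, §3.3 ¶1 and Assumption 2.0.3 (arXiv:2410.23241 pp. 8, 14)] [cite: Mazur1978, Prop. 5.4]
[cite: JetchevSkinnerWan2017, §7.4.1] -/
theorem coChainMemberField_gordTwo_of_coIMCField_of_control
    (hKo : ∀ (N : ℕ) [NeZero N] (W : WeierstrassCurve ℚ) (K : Type) [Field K] [NumberField K],
      kolyvagin N W K)
    (hPar : nonempty_modularParametrizationData)
    (hCtl : ∀ (W : WeierstrassCurve ℚ) [W.IsElliptic] [W.IsGloballyMinimal] (p : ℕ) [Fact p.Prime],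
      W.analyticRank = 1 → p ≠ 2 → ClassX3 W p → Additive.SubSemistableTwist W p →
      AdditiveControlInputManinAt W p)
    (hCo : ∀ (W : WeierstrassCurve ℚ) [W.IsElliptic] [W.IsGloballyMinimal] (p : ℕ) [Fact p.Prime],
      p ≠ 2 → ClassX3 W p → Additive.SubGordTwo W p →
      (∃ Φ : AddSubgroup (geomTorsion W (p : ℤ)), IsRationalLine W p Φ ∧ ¬ LineDecompositionTrivialAt W p Φ) →
      ∀ (K : Type) [Field K] [NumberField K], IsImaginaryQuadratic K → NumberField.discr K ≠ -3 →
        AdditiveIMCUpperBDPInputManinAtField W p K)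
    (W : WeierstrassCurve ℚ) [W.IsElliptic] [W.IsGloballyMinimal] (p : ℕ) [Fact p.Prime]
    (hr : W.analyticRank = 1) (hp2 : p ≠ 2) (hX : ClassX3 W p) (hS : Additive.SubGordTwo W p)
    (K : Type) [Field K] [NumberField K] (hK : IsImaginaryQuadratic K)
    (hpd : ¬ (p : ℤ) ∣ NumberField.discr K) (hdK : NumberField.discr K ≠ -3) :
    ∃ (W₁ : WeierstrassCurve ℚ) (_ : W₁.IsElliptic) (_ : W₁.IsGloballyMinimal),
      IsIsogenous W W₁ ∧ W₁.conductorNorm ℤ = W.conductorNorm ℤ ∧ Additive.N10.Locus W₁ p ∧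
      (∀ Q : (W₁.baseChange K).toAffine.Point, p • Q = 0 → Q = 0) ∧ AdditiveCoStepLInputManinAtField W₁ p K := by
  have hp : p.Prime := Fact.out
  obtain ⟨W₁, hE₁, hmin₁, φ, m, -, -, hN₁, -, hred₁, hlat₁, htf₁⟩ :=
    GoodMember.exists_goodMember_of_modularParametrization hPar hp2 W hX hS K hK.1 hpd
  have hiso₁ : IsIsogenous W₁ W := ⟨φ⟩
  have hiso₁' : IsIsogenous W W₁ := hiso₁.symm_of_isElliptic
  -- `W₁` lies on the cell, with `r_an(W₁) = 1`
  have hG : TypeG W p := (subGord_iff_typeG_of_addv W p hp2 hX.2).mp hS.1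
  have hadd₁ : Addv W₁ p := Addv.of_isIsogenous_of_typeG hX.2 hG hiso₁'
  have hSG₁ : SubGord W₁ p := (subGord_iff_of_isIsogenous hp2 hX.2 hiso₁').mp hS.1
  have he₁ : semistabilityIndex W₁ p = 2 :=
    (semistabilityIndex_eq_of_isIsogenous_of_typeG_of_addv hp2 hX.2 hG hiso₁').trans hS.2
  have hX₁ : ClassX3 W₁ p := ⟨hred₁, hadd₁⟩
  have hS₁ : Additive.SubGordTwo W₁ p := ⟨hSG₁, he₁⟩
  have hr₁ : W₁.analyticRank = 1 := by rw [analyticRank_eq_of_isIsogenous' hiso₁, hr]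
  have hloc₁ : Additive.N10.Locus W₁ p :=
    (Additive.N10.locus_iff_cells W₁ p).mpr
      ((Additive.N10.cellM_or_cellGordTwo_of_classX3_of_subSemistableTwist W₁ p hp2 hX₁ (Or.inr hS₁)).elim
        Or.inl (fun h ↦ Or.inr (Or.inl h)))
  -- co-STEP L♯ at `W₁` AT THE FIELD `K`: field-local co-socket at the good member + control + Kolyvagin
  have hco : AdditiveCoStepLInputManinAtField W₁ p K :=
    additiveCoStepLInputManinAtField_of_kolyvagin_of_control_of_imcUpperField (fun N _ K _ _ ↦ hKo N W₁ K)
      (hCtl W₁ p hr₁ hp2 hX₁ (Or.inr hS₁)) (hCo W₁ p hp2 hX₁ hS₁ hlat₁ K hK hdK)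
  exact ⟨W₁, hE₁, hmin₁, hiso₁', hN₁, hloc₁, htf₁, hco⟩

/-- **Co-chain member on the (M) cell AT A FIELD** — from the class-wide (M) co-socket `hCoM` (this seat's record
`coIMC_potMult_of_PotMultRead` supplies it at EVERY field; no sliver arises on (M)):
`coChainMember_potMult_of_coIMC_of_control` read field-locally. [cite: Mazur1978, Prop. 5.4] [cite: JetchevSkinnerWan2017, §7.4.1] -/
theorem coChainMemberField_potMult_of_coIMC_of_control
    (hKo : ∀ (N : ℕ) [NeZero N] (W : WeierstrassCurve ℚ) (K : Type) [Field K] [NumberField K],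
      kolyvagin N W K)
    (hPar : nonempty_modularParametrizationData)
    (hCtl : ∀ (W : WeierstrassCurve ℚ) [W.IsElliptic] [W.IsGloballyMinimal] (p : ℕ) [Fact p.Prime],
      W.analyticRank = 1 → p ≠ 2 → ClassX3 W p → Additive.SubSemistableTwist W p →
      AdditiveControlInputManinAt W p)
    (hCoM : ∀ (W : WeierstrassCurve ℚ) [W.IsElliptic] [W.IsGloballyMinimal] (p : ℕ) [Fact p.Prime],
      p ≠ 2 → ClassX3 W p → Additive.SubM W p →
      (∃ Φ : AddSubgroup (geomTorsion W (p : ℤ)), IsRationalLine W p Φ ∧ ¬ LineDecompositionTrivialAt W p Φ) →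
      AdditiveIMCUpperBDPInputManinAt W p)
    (W : WeierstrassCurve ℚ) [W.IsElliptic] [W.IsGloballyMinimal] (p : ℕ) [Fact p.Prime]
    (hr : W.analyticRank = 1) (hp2 : p ≠ 2) (hX : ClassX3 W p) (hM : Additive.SubM W p)
    (K : Type) [Field K] [NumberField K] (hK : IsImaginaryQuadratic K)
    (hpd : ¬ (p : ℤ) ∣ NumberField.discr K) :
    ∃ (W₁ : WeierstrassCurve ℚ) (_ : W₁.IsElliptic) (_ : W₁.IsGloballyMinimal),
      IsIsogenous W W₁ ∧ W₁.conductorNorm ℤ = W.conductorNorm ℤ ∧ Additive.N10.Locus W₁ p ∧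
      (∀ Q : (W₁.baseChange K).toAffine.Point, p • Q = 0 → Q = 0) ∧ AdditiveCoStepLInputManinAtField W₁ p K := by
  obtain ⟨W₁, hE₁, hmin₁, h1, hN₁, hloc₁, htf₁, hco⟩ :=
    coChainMember_potMult_of_coIMC_of_control hKo hPar hCtl hCoM W p hr hp2 hX hM K hK hpd
  exact ⟨W₁, hE₁, hmin₁, h1, hN₁, hloc₁, htf₁, additiveCoStepLInputManinAtField_of_inputManinAt hco K⟩

/-- **The second wing on the whole door from the FIELD-LOCAL (G-ord) co-socket off the sliver, the class-wide (M)
co-socket, the control conclusion and the OFF-SLIVER twist-unit datum** — `missingUpperBoundAt_sstTwist_of_coIMCs_of_control_of_twistUnitField`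
(p489359) with `hCoG` asked field-locally at `d_K ≠ −3` only and `hTU` off the sliver. CONDITIONAL on every
displayed hypothesis; closes nothing; BSD not advanced. [cite: JetchevSkinnerWan2017, §7.4.1]
[cite: Miller2011LMS, Def. 1.1] [cite: KellerYin2024b, Thm. 3.5.1 and Assumption 2.0.3 (preprint)] [cite: KrizLi2019, Thm. 1.20] -/
theorem missingUpperBoundAt_sstTwist_of_coIMCsField_of_control_of_twistUnitFieldOffSliver
    (hGZ : ∀ (N : ℕ) [NeZero N] (W : WeierstrassCurve ℚ) (K : Type) [Field K] [NumberField K],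
      gross_zagier N W K)
    (hKo : ∀ (N : ℕ) [NeZero N] (W : WeierstrassCurve ℚ) (K : Type) [Field K] [NumberField K],
      kolyvagin N W K)
    (hGZK : rank_eq_analyticRank_of_analyticRank_le_one) (hmod : hasEntireLFunction_rat)
    (hPar : nonempty_modularParametrizationData) (hGZ73 : GrossZagier1986_thm_I_7_3)
    (hCassels : bsdRHS_eq_of_isIsogenous)
    (hHP : ∀ (W : WeierstrassCurve ℚ) (K : Type) [Field K] [NumberField K], exists_isHeegnerPoint W K)
    (hCtl : ∀ (W : WeierstrassCurve ℚ) [W.IsElliptic] [W.IsGloballyMinimal] (p : ℕ) [Fact p.Prime],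
      W.analyticRank = 1 → p ≠ 2 → ClassX3 W p → Additive.SubSemistableTwist W p →
      AdditiveControlInputManinAt W p)
    (hCoG : ∀ (W : WeierstrassCurve ℚ) [W.IsElliptic] [W.IsGloballyMinimal] (p : ℕ) [Fact p.Prime],
      p ≠ 2 → ClassX3 W p → Additive.SubGordTwo W p →
      (∃ Φ : AddSubgroup (geomTorsion W (p : ℤ)), IsRationalLine W p Φ ∧ ¬ LineDecompositionTrivialAt W p Φ) →
      ∀ (K : Type) [Field K] [NumberField K], IsImaginaryQuadratic K → NumberField.discr K ≠ -3 →
        AdditiveIMCUpperBDPInputManinAtField W p K)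
    (hCoM : ∀ (W : WeierstrassCurve ℚ) [W.IsElliptic] [W.IsGloballyMinimal] (p : ℕ) [Fact p.Prime],
      p ≠ 2 → ClassX3 W p → Additive.SubM W p →
      (∃ Φ : AddSubgroup (geomTorsion W (p : ℤ)), IsRationalLine W p Φ ∧ ¬ LineDecompositionTrivialAt W p Φ) →
      AdditiveIMCUpperBDPInputManinAt W p)
    (hTU : ∀ (W : WeierstrassCurve ℚ) [W.IsElliptic] [W.IsGloballyMinimal] (p : ℕ) [Fact p.Prime],
      W.analyticRank = 1 → p ≠ 2 → ClassX3 W p → Additive.SubSemistableTwist W p → TwistUnitFieldOffSliverAt W p) :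
    ∀ (W : WeierstrassCurve ℚ) [W.IsElliptic] [W.IsGloballyMinimal] (p : ℕ) [Fact p.Prime],
      W.analyticRank = 1 → p ≠ 2 → ClassX3 W p → Additive.SubSemistableTwist W p → MissingUpperBoundAt W p := by
  intro W _ _ p _ hr hp2 hX hS
  have hpN : p ∣ W.conductorNorm ℤ := (W.dvd_conductorNorm_iff_not_hasGoodReductionAtPrime p).mpr hX.2.1
  refine missingUpperBoundAt_of_goodMemberCoStepLField_of_twistUnitFieldOffSliver hGZ hKo hGZK hmod hGZ73 hCassels
    hHP W p hr hp2 hpN (fun K _ _ hK _ hpd hdK ↦ ?_) (hTU W p hr hp2 hX hS)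
  rcases hS with hM | hGo
  · exact coChainMemberField_potMult_of_coIMC_of_control hKo hPar hCtl hCoM W p hr hp2 hX hM K hK hpd
  · exact coChainMemberField_gordTwo_of_coIMCField_of_control hKo hPar hCtl hCoG W p hr hp2 hX hGo K hK hpd hdK

/-! ### §3 The (G-ord) field-local co-socket record WITHOUT the sliver stub, and the leaf candidate v3 -/

/-- **The (G-ord, `e = 2`) FIELD-LOCAL co-socket record at fields with `d_K ≠ −3`, BRANCH CURRENCY, Gross-free,
NO sliver stub.** For every `(W, p)` with `p ≠ 2`, `ClassX3 W p`, `SubGordTwo W p`, KY-normalised, and every imaginary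
quadratic `K` with `d_K ≠ −3`: `AdditiveIMCUpperBDPInputManinAtField W p K` from the named facts + `hKYb` (PRE) +
`hCHx` (PUB) + `hValU` (`KYReadCHValueUnit`) — this seat's per-datum theorem
`additiveIMCUpperBDPOnTreeLeAt_of_KY_branch_of_valueAtUnit_conj` (the `d_K = −3` case never arises). CONDITIONAL on the
displayed hypotheses; nothing asserted about BSD. [cite: KellerYin2024b, Thm. 3.5.1, Rem. 3.5.2, Assumption 2.0.3 (preprint)]
[cite: CastellaHsieh2018, Prop. 3.8, Thm. 5.7 and Lemma 5.4] [cite: JetchevSkinnerWan2017, §7.4.1] -/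
theorem additiveIMCUpperBDPInputManinAtField_of_facts_of_KY_branch_of_CHValueUnit
    (hPT : ∀ (K : Type) [Field K] [NumberField K], poitouTate_selmerStructure_duality K)
    (hKo : ∀ (N : ℕ) [NeZero N] (W : WeierstrassCurve ℚ) (K : Type) [Field K] [NumberField K],
      Literature.NumberTheory.EllipticCurves.kolyvagin N W K)
    (hGZ : ∀ (N : ℕ) [NeZero N] (W : WeierstrassCurve ℚ) (K : Type) [Field K] [NumberField K],
      Literature.NumberTheory.EllipticCurves.gross_zagier N W K)
    (hmod : hasEntireLFunction_rat) (hPar : nonempty_modularParametrizationData)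
    (hRat : phi_heegnerPointOfConductor_mem_ringClassField) (hCST : thm11_ringClassChar)
    (hKYb : thm351_charIdeal_eq_branch_OPEN) (hCHx : castellaHsieh2018_exists_isBranchBDPLFunction)
    (hValU : KYReadCHValueUnit) :
    ∀ (W : WeierstrassCurve ℚ) [W.IsElliptic] [W.IsGloballyMinimal] (p : ℕ) [Fact p.Prime],
      p ≠ 2 → ClassX3 W p → Additive.SubGordTwo W p →
      (∃ Φ : AddSubgroup (geomTorsion W (p : ℤ)), IsRationalLine W p Φ ∧ ¬ LineDecompositionTrivialAt W p Φ) →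
      ∀ (K : Type) [Field K] [NumberField K], IsImaginaryQuadratic K → NumberField.discr K ≠ -3 →
        AdditiveIMCUpperBDPInputManinAtField W p K := by
  intro W _ _ p _ hp2 hX hS hlat K _ _ hK hdK
  have hp : p.Prime := Fact.out
  have hcase : W.HasGoodOrdinaryReductionOverQuadraticAt p :=
    hasGoodOrdinaryReductionOverQuadraticAt_of_subGordTwo hp2 W hX hS
  obtain ⟨Φ₀, hΦ₀, -⟩ := id hlat
  have hred : Red W p := red_of_isRationalLine hΦ₀
  obtain ⟨W', hE', hmin', C₂, hW, hord, hΔ⟩ :=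
    exists_goodOrd_partner_presentation_of_subGordTwo_odd hp2 W hX hS
  subst hW
  haveI : NeZero (W'.conductorNorm ℤ) := ⟨(WeierstrassCurve.conductorNorm_pos_holds W').ne'⟩
  haveI : ((@WeierstrassCurve.toCharNeTwoNF ℚ _ W' (invertibleOfNonzero two_ne_zero)) • W').IsCharNeTwoNF :=
    @WeierstrassCurve.toCharNeTwoNF_spec ℚ _ W' (invertibleOfNonzero two_ne_zero)
  intro N _ Dt H ι P hr' hloc hN _ hodd hunit hHe hL hP hnt htf κ hκ γ _ 𝔭 h𝔭 he hf
  obtain ⟨n, hn⟩ :=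
    Summit.BirchSwinnertonDyer.BirchSwinnertonDyer.Theorems.SchneiderFreeAdditiveX3.exists_hasCharValuationAt_of_pt_of_kolyvagin
      hPT hKo _ p hr' hp2 hX (Or.inr hS) N K Dt H ι P hr' hloc hN hK hodd hunit hHe hL hP hnt κ hκ γ 𝔭 h𝔭
      he hf
  obtain ⟨Dt'⟩ := hPar W'
  haveI := (finiteDimensional_and_isGalois_ringClassField hK ι hp.ne_zero).1
  haveI : FiniteDimensional ℚ (ringClassField K ι p) := Module.Finite.trans K _
  haveI : NumberField (ringClassField K ι p) := NumberField.mk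
  haveI : IsGalois ℚ K := Literature.FieldTheory.Galois.isGalois_of_finrank_eq_two hK.1
  have hV' : padicValInt p W'.minimalDiscriminantInt < 6 := by rw [hΔ]; norm_num
  obtain ⟨𝔭', h𝔭', hne, he', hf'⟩ := exists_conjugate_degreeOne hK.1 h𝔭 he hf
  obtain ⟨ι₀⟩ := PadicAlgCl.nonempty_ringEquiv_complex p
  obtain ⟨ι', -, hι'⟩ := exists_datum_forall_mem_iff p ι₀ hK h𝔭'
  have hval := hValU p W' _ C₂ N K Dt H ι P hr' hloc hN hK hodd hunit hHe hL hP hnt hp2 hord hdK κ hκ γ 𝔭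
    h𝔭 he hf Dt' 𝔭' h𝔭' he' hf' hne ι' hι'
  exact additiveIMCUpperBDPOnTreeLeAt_of_KY_branch_of_valueAtUnit_conj hmod hPar hRat hCST hKYb hCHx hp2 W'
    hord.1 hV' _ C₂ hX.2 K hK hHe hodd hdK hunit hκ h𝔭 he hf h𝔭' he' hf' hne hι' (hGZ N _ K) (hKo N _ K) Dt H
    ι P hP hnt hn hN hcase hred hlat htf ι Dt' hval

/-- **The sibling route's RUNG-LEAF candidate `Upper.AdditiveX3RankOneUpper` from NAMED inputs + the OFF-SLIVER
twist-unit certificate, v3 — NO `KYReadSliverUpper`:** `PrintedFacts → ControlFacts → (CM-rationality ∧ CST 1.1) →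
(Darmon 3.6 ∧ CST 1.5) → thm351_charIdeal_eq_branch_OPEN → castellaHsieh2018_… → KYReadCHValueUnit → KYCHMUnitOriented →
hTU′ (`TwistUnitFieldOffSliverAt` on the cell) → AdditiveX3RankOneUpper`. The (G-ord) co-socket is §3's field-local
record, the (M) co-socket this seat's `coIMC_potMult_of_PotMultRead`, the control the CLOSED item 19548.
CONDITIONAL on every displayed hypothesis; the leaf is declared, NOT registered; closes no item; BSD NOT advanced.
[cite: Miller2011LMS, Def. 1.1] [cite: JetchevSkinnerWan2017, §7.4.1 (arXiv:1512.06894 p. 30)]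
[cite: KellerYin2024b, Thm. 3.5.1 and §3.4–3.5 (arXiv:2410.23241) (preprint; hypotheses)]
[cite: CastellaHsieh2018, Prop. 3.8, Thm. 5.7 and Lemma 5.4] [cite: KrizLi2019, Thm. 1.20 (shape of hTU′)] -/
theorem additiveX3RankOneUpper_of_KYReadBranch_of_PotMultRead_of_twistUnitFieldOffSliver (hF : PrintedFacts)
    (hCF : ControlFacts)
    (hRG : phi_heegnerPointOfConductor_mem_ringClassField ∧ thm11_ringClassChar)
    (hRM : Literature.NumberTheory.EllipticCurves.phi_heegnerPointOfConductor_mem_range_map_ringClassField_of_prime_dvd_level ∧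
      Literature.NumberTheory.EllipticCurves.thm15_ringClassChar_primeConductor_dvd_level)
    (hKYb : thm351_charIdeal_eq_branch_OPEN) (hCHx : castellaHsieh2018_exists_isBranchBDPLFunction)
    (hValU : KYReadCHValueUnit) (hKYu : KYCHMUnitOriented)
    (hTU : ∀ (W : WeierstrassCurve ℚ) [W.IsElliptic] [W.IsGloballyMinimal] (p : ℕ) [Fact p.Prime],
      W.analyticRank = 1 → p ≠ 2 → ClassX3 W p → Additive.SubSemistableTwist W p → TwistUnitFieldOffSliverAt W p) :
    AdditiveX3RankOneUpper := by
  have hCoM := coIMC_potMult_of_PotMultRead hF hCF hRM hKYu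
  obtain ⟨hGZ, hKo, hGZK, hmod, hPar, hCas, hGZ73, -, -, hHP, -, -, -⟩ := hF
  have hCoG := additiveIMCUpperBDPInputManinAtField_of_facts_of_KY_branch_of_CHValueUnit hCF.1 hKo hGZ hmod hPar hRG.1
    hRG.2 hKYb hCHx hValU
  have hCtl := SchneiderFreeAdditiveX3.anticycControlAdditiveKF_proof hCF.1 hCF.2.1 hCF.2.2.1 hCF.2.2.2 hKo
  exact missingUpperBoundAt_sstTwist_of_coIMCsField_of_control_of_twistUnitFieldOffSliver hGZ hKo hGZK hmod hPar hGZ73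
    hCas hHP hCtl hCoG hCoM hTU

end Summit.BirchSwinnertonDyer.BirchSwinnertonDyer.Theorems.SchneiderFree.Upper

end
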